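import Literature.Barriers.CriticalPhenomena.PlaquetteWalkAngleLimitAboveCriterion
import HarnessLib

/-!
# Barrier catalogue (SAWScalingLimit): the below-coherence criterion REDUCED TO THE PHASE («COLUMN LAW» below the root plaquette, assembly)

`Z → ∞` limit model of the printed Yang–Baxter weights [GlazmanManolescu2019, §1, eq. (1)]; the «RECTANGLE COEFFICIENT» line of the venture lane «pcv-sawmu»
(b-engine-1 g26). Row mirror of `PlaquetteWalkAngleLimitAboveCriterion` through `ΩG.mirrorAt` (#WoundStraddle; the limit cost is reflection invariant,
`cost_map_mirrorRow`): ★★★ `ΩG.bottom_row_of_cost_seven_vert_below` — a wound class-`B2a` walk of limit cost `7` with a vertical end and a turning first arc at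
a rhombus STRICTLY BELOW the root row has that rhombus in its BOTTOM row; so its first arc there uses `N`, never `S`, the free fourth side is `S`
(★★ `ΩG.ext₃_fst_eq_S_of_below`: the class-`B2b` members below `w` have slot `S`, as the census says), and ★★★★
`vertexFunctional_printed_zero_set_finite_below_of_phase`: below the root row the below-coherence criterion of #ColumnCoherence needs only the PHASE statement
X(ext₃) ∈ {3, 0} (its cost-`5` class-`B2a` demand is empty by `ΩG.rootRow_of_cost_five`). [GlazmanManolescu2019 §1 Fig. 1, eq. (1), Lemma 2.1 (eq. (CR)),
Remark 2.2, §4.2 (lattice symmetries); Glazman2015WeightedSAW Lemma 3.1 (proof, pp. 6–7); CourantRobbins1958 Ch. V App. §2]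
-/

noncomputable section

open private IsNS ext₃_fst z₃_spec fc_fh sides_distinctG returnSide_of_isB2a from
  Literature.Probability.RandomPlanarGeometry.YangBaxterSAWGeneralDomain

namespace Literature.Probability.RandomPlanarGeometry.SAW.YangBaxter

open Real
open Literature.Barriers.CriticalPhenomena.PlaquetteWalk

namespace ΩG

variable {D : Set Face} {w r : Face} {ω : ΩG D (w.side .W) r}

/-- ★★★ **THE COST-`7` VERTICAL-END PARENTS BELOW THE ROOT ROW RETURN TO THEIR BOTTOM ROW** (row mirror of `top_row_of_cost_seven_vert_above`).
[cite: GlazmanManolescu2019, §1, Fig. 1 and eq. (1); Lemma 2.1; §4.2 (lattice symmetries)] [cite: Glazman2015WeightedSAW, Lemma 3.1 (proof, pp. 6–7)]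
[cite: CourantRobbins1958, Ch. V Appendix §2 (the even–odd rule)] -/
theorem bottom_row_of_cost_seven_vert_below (hh : holeFaceW w ∉ D) (hr : RootedFace D (w.side .W) r) (h : ω.IsB2a)
    (hA : ω.AJ hr h (toC (midPt (w.side .W))) ≠ 0) (hc : cost (slotOfSide ω.1) ω.2.mids = 7) (hz : ω.1 = .E ∨ ω.1 = .W)
    (hNS : arcKind (ω.2.sIn ω.2.firstHitG) (ω.2.sOut ω.2.firstHitG) ≠ .straight) (hbelow : r.2 < w.2) :
    ∀ j < ω.2.arcs.length, r.2 ≤ (ω.2.fc j).2 := by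
  have hh' : holeFaceW w ∉ rowMirrorDom w D := by
    rw [mem_rowMirrorDom]
    have e : mirrorRowFace w.2 (holeFaceW w) = holeFaceW w := by
      simp only [mirrorRowFace, holeFaceW]; exact Prod.ext rfl (by simp only; ring)
    rw [e]; exact hh
  have hr' := rootedFace_rowMirrorDom_mirrorRowFace (w := w) hr
  have h' := isB2a_mirrorAt hr h
  have hA' := AJ_mirrorAt_ne_zero hr h hA
  have hc' : cost (slotOfSide ω.mirrorAt.1) ω.mirrorAt.2.mids = 7 := by
    show cost (slotOfSide (mirrorSide ω.1)) (ω.2.mids.map (mirrorRow w.2)) = 7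
    rw [cost_map_mirrorRow]; exact hc
  have hz' : ω.mirrorAt.1 = .E ∨ ω.mirrorAt.1 = .W := by
    show mirrorSide ω.1 = .E ∨ mirrorSide ω.1 = .W
    rcases hz with e | e <;> rw [e]
    · exact Or.inl rfl
    · exact Or.inr rfl
  have hlen : ω.mirrorAt.2.arcs.length = ω.2.arcs.length := YBWalk.length_arcs_eq_of_mids_mirror ω.mirrorAt_mids
  have hF : ω.mirrorAt.2.firstHitG = ω.2.firstHitG := YBWalk.firstHitG_eq_of_mids_mirror ω.mirrorAt_mids
  have hNS' : arcKind (ω.mirrorAt.2.sIn ω.mirrorAt.2.firstHitG) (ω.mirrorAt.2.sOut ω.mirrorAt.2.firstHitG) ≠ .straight := by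
    obtain ⟨e1, e2⟩ := YBWalk.sIn_sOut_eq_of_mids_mirror ω.mirrorAt_mids (i := ω.2.firstHitG) (ω.fh_lt h)
    rw [hF, e1, e2, arcKind_mirrorSide]
    intro e
    apply hNS
    rw [← mirrorKind_mirrorKind (arcKind _ _), e]; rfl
  have habove' : w.2 < (mirrorRowFace w.2 r).2 := by simp only [mirrorRowFace]; omega
  have htop := top_row_of_cost_seven_vert_above (ω := ω.mirrorAt) hh' hr' h' hA' hc' hz' hNS' habove'
  intro j hj
  have hj' : j < ω.mirrorAt.2.arcs.length := by rw [hlen]; exact hj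
  have := htop j hj'
  rw [YBWalk.fc_eq_of_mids_mirror ω.mirrorAt_mids hj] at this
  simp only [mirrorRowFace] at this
  omega

/-- ★★ **Hence the first arc in `r` uses `N` and not `S`** (below the root row). [cite: GlazmanManolescu2019, §1, Fig. 1 and eq. (1); Remark 2.2]
[cite: Glazman2015WeightedSAW, Lemma 3.1 (proof, pp. 6–7)] -/
theorem usesSide_N_of_cost_seven_vert_below (hh : holeFaceW w ∉ D) (hr : RootedFace D (w.side .W) r) (h : ω.IsB2a)
    (hA : ω.AJ hr h (toC (midPt (w.side .W))) ≠ 0) (hc : cost (slotOfSide ω.1) ω.2.mids = 7) (hz : ω.1 = .E ∨ ω.1 = .W)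
    (hNS : arcKind (ω.2.sIn ω.2.firstHitG) (ω.2.sOut ω.2.firstHitG) ≠ .straight) (hbelow : r.2 < w.2) :
    (ω.2.sIn ω.2.firstHitG = .N ∨ ω.2.sOut ω.2.firstHitG = .N) ∧ ω.2.sIn ω.2.firstHitG ≠ .S ∧ ω.2.sOut ω.2.firstHitG ≠ .S := by
  have hbot := bottom_row_of_cost_seven_vert_below hh hr h hA hc hz hNS hbelow
  have hF := ω.fh_lt h
  have hfcF := (fc_fh ω hr h).1
  obtain ⟨hn1, hn2⟩ := forall_bottom_ne_S hh hr h hbot hbelow _ hF (by rw [hfcF])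
  have hne := ω.2.sIn_ne_sOut hF
  refine ⟨?_, hn1, hn2⟩
  revert hNS hne hn1 hn2
  cases ω.2.sIn ω.2.firstHitG <;> cases ω.2.sOut ω.2.firstHitG <;> decide

/-- The fourth side of a rhombus whose other three sides are `N` or horizontal, one of them `N`, is `S`. [cite: GlazmanManolescu2019, §1, Fig. 1] -/
private theorem fourth_eq_S {u a b t : Side} (hN : a = .N ∨ b = .N) (hn1 : a ≠ .S) (hn2 : b ≠ .S) (hs0 : a ≠ t) (hs1 : b ≠ t)
    (hz0 : u ≠ a) (hz1 : u ≠ b) (hz2 : u ≠ t) (hz : t = .E ∨ t = .W) (hne : a ≠ b) : u = .S := by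
  cases u <;> cases a <;> cases b <;> cases t <;> simp_all

/-- ★★ **THE SLOT OF A CLASS-`B2b` MEMBER BELOW THE ROOT ROW IS `S`.** [cite: GlazmanManolescu2019, §1, Fig. 1 and eq. (1); Lemma 2.1 (proof: the groups of three walks); Remark 2.2]
[cite: Glazman2015WeightedSAW, Lemma 3.1 (proof, pp. 6–7)] -/
theorem ext₃_fst_eq_S_of_below (hh : holeFaceW w ∉ D) (hr : RootedFace D (w.side .W) r) (h : ω.IsB2a)
    (hA : ω.AJ hr h (toC (midPt (w.side .W))) ≠ 0) (hc : cost (slotOfSide ω.1) ω.2.mids = 7) (hz : ω.1 = .E ∨ ω.1 = .W)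
    (hNS : arcKind (ω.2.sIn ω.2.firstHitG) (ω.2.sOut ω.2.firstHitG) ≠ .straight) (hbelow : r.2 < w.2) :
    (ω.ext₃ hr).1 = .S := by
  obtain ⟨-, hsInF, hsOutF⟩ := fc_fh ω hr h
  have hN : IsNS ω hr := ⟨h, by rw [← hsInF, ← hsOutF]; exact hNS⟩
  rw [ext₃_fst ω hr hN]
  have hz3 := z₃_spec ω hr h
  have hd := ω.2.sides_distinctG hr h.1
  rw [ω.returnSide_of_isB2a h] at hd
  have hs0 : ω.2.sIn ω.2.firstHitG ≠ ω.1 := by rw [hsInF]; exact fun e => hd.2.1 e.symm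
  have hs1 : ω.2.sOut ω.2.firstHitG ≠ ω.1 := by rw [hsOutF]; exact fun e => hd.2.2 e.symm
  have hz0 : ω.z₃ hr h ≠ ω.2.sIn ω.2.firstHitG := by rw [hsInF]; exact hz3.1
  have hz1 : ω.z₃ hr h ≠ ω.2.sOut ω.2.firstHitG := by rw [hsOutF]; exact hz3.2.1
  have hz2 : ω.z₃ hr h ≠ ω.1 := hz3.2.2
  obtain ⟨hNside, hn1, hn2⟩ := usesSide_N_of_cost_seven_vert_below hh hr h hA hc hz hNS hbelow
  exact fourth_eq_S hNside hn1 hn2 hs0 hs1 hz0 hz1 hz2 hz (ω.2.sIn_ne_sOut (ω.fh_lt h))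

end ΩG

end Literature.Probability.RandomPlanarGeometry.SAW.YangBaxter

namespace Literature.Barriers.CriticalPhenomena.PlaquetteWalk

open Literature.Probability.RandomPlanarGeometry.SAW.YangBaxter
open Real

variable (Dl : List Face)

open Classical in
/-- ★★★★ **THE BELOW-COHERENCE CRITERION REDUCED TO THE PHASE.** At a rooted rhombus `f₀` STRICTLY BELOW the root row with `w.1 ≤ f₀.1` (hole root `w.side W`
of `dom Dl`, hole absent): if every wound class-`B2a` walk at `f₀` with a turning first arc and a cost-`5` extension gives that extension PHASE INDEX `3` or `0`,
and one exists, the zero set in `θ ∈ (0, π)` of the printed-weight vertex functional at `f₀` is finite (≤ `4·maxExp − 4` zeros).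
[cite: GlazmanManolescu2019, Lemma 2.1 and eq. (1); Remark 2.2] [cite: Glazman2015WeightedSAW, Lemma 3.1 (proof, pp. 6–7)]
[cite: CourantRobbins1958, Ch. V Appendix §2 (the even–odd rule)] -/
theorem vertexFunctional_printed_zero_set_finite_below_of_phase {w f₀ : Face} (hh : holeFaceW w ∉ dom Dl)
    (hr : RootedFace (dom Dl) (w.side .W) f₀) (hbelow : f₀.2 < w.2) (hcol : w.1 ≤ f₀.1)
    (hphase : ∀ (ω : ΩG (dom Dl) (w.side .W) f₀) (h : ω.IsB2a), ω.AJ hr h (toC (midPt (w.side .W))) ≠ 0 →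
      arcKind (ω.2.sIn ω.2.firstHitG) (ω.2.sOut ω.2.firstHitG) ≠ .straight →
        cost (slotOfSide (ω.ext₃ hr).1) (ω.ext₃ hr).2.mids = 5 →
          phaseIndex (ω.ext₃ hr).2.mids = 3 ∨ phaseIndex (ω.ext₃ hr).2.mids = 0)
    (hex : ∃ (ω : ΩG (dom Dl) (w.side .W) f₀) (h : ω.IsB2a), ω.AJ hr h (toC (midPt (w.side .W))) ≠ 0 ∧
      arcKind (ω.2.sIn ω.2.firstHitG) (ω.2.sOut ω.2.firstHitG) ≠ .straight ∧
        cost (slotOfSide (ω.ext₃ hr).1) (ω.ext₃ hr).2.mids = 5) :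
    {θ ∈ Set.Ioo 0 π | vertexFunctional (printedWeights θ) tFiveEighths (ybCoeff θ) Dl (w.side .W) f₀ = 0}.Finite ∧
      {θ ∈ Set.Ioo 0 π | vertexFunctional (printedWeights θ) tFiveEighths (ybCoeff θ) Dl (w.side .W) f₀ = 0}.ncard ≤
        4 * maxExp Dl (w.side .W) f₀ + 1 - 5 := by
  have hmem : ∀ ω : ΩG (dom Dl) (w.side .W) f₀,
      ω ∈ (ΩG.setB2a (dom Dl) (w.side .W) f₀).filter (fun ω => ¬ω.Unwound hr) ↔
        ∃ h : ω.IsB2a, ω.AJ hr h (toC (midPt (w.side .W))) ≠ 0 := by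
    intro ω
    rw [Finset.mem_filter, ΩG.unwound_iff_AJ_root_eq_zero]
    unfold ΩG.setB2a
    rw [Finset.mem_filter]
    simp only [Finset.mem_univ, true_and, not_forall]
    constructor
    · rintro ⟨h, ⟨h', hA⟩⟩; exact ⟨h', hA⟩
    · rintro ⟨h, hA⟩; exact ⟨h, ⟨h, hA⟩⟩
  have hturn : ∀ (ω : ΩG (dom Dl) (w.side .W) f₀) (h : ω.IsB2a), IsNS ω hr →
      arcKind (ω.2.sIn ω.2.firstHitG) (ω.2.sOut ω.2.firstHitG) ≠ .straight := by
    intro ω h hN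
    obtain ⟨-, hf2, hf3⟩ := ΩG.fc_fh' ω hr h
    rw [hf2, hf3]; exact hN.2
  refine vertexFunctional_printed_zero_set_finite_of_belowCoherent Dl hh hr (fun ω hω => ?_) ?_
  · obtain ⟨h, hA⟩ := (hmem ω).1 hω
    refine ⟨fun hc5 => absurd (ΩG.rootRow_of_cost_five hh hr h hA hc5 hcol) (ne_of_lt hbelow), fun hN hc => ?_⟩
    have hNS := hturn ω h hN
    rcases (ΩG.cost_ext₃_eq_five_iff hr h hNS).1 hc with ⟨hc5, -⟩ | ⟨hc7, hEW⟩
    · exact absurd (ΩG.rootRow_of_cost_five hh hr h hA hc5 hcol) (ne_of_lt hbelow)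
    · refine ⟨?_, hphase ω h hA hNS hc⟩
      rw [ΩG.ext₃_fst_eq_S_of_below hh hr h hA hc7 hEW hNS hbelow]; rfl
  · obtain ⟨ω, h, hA, hNS, hc⟩ := hex
    obtain ⟨-, hsInF, hsOutF⟩ := fc_fh ω hr h
    have hN : IsNS ω hr := ⟨h, by rw [← hsInF, ← hsOutF]; exact hNS⟩
    exact ⟨ω, (hmem ω).2 ⟨h, hA⟩, Or.inr ⟨hN, hc⟩⟩

/-- ★★★★ **Hence some `θ ∈ (0, π)` has a NON-VANISHING printed vertex functional below the root row**, under the same phase hypothesis.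
[cite: GlazmanManolescu2019, Lemma 2.1 and eq. (1); Remark 2.2] [cite: Glazman2015WeightedSAW, Lemma 3.1 (proof, pp. 6–7)] -/
theorem vertexFunctional_printed_exists_ne_zero_below_of_phase {w f₀ : Face} (hh : holeFaceW w ∉ dom Dl)
    (hr : RootedFace (dom Dl) (w.side .W) f₀) (hbelow : f₀.2 < w.2) (hcol : w.1 ≤ f₀.1)
    (hphase : ∀ (ω : ΩG (dom Dl) (w.side .W) f₀) (h : ω.IsB2a), ω.AJ hr h (toC (midPt (w.side .W))) ≠ 0 →
      arcKind (ω.2.sIn ω.2.firstHitG) (ω.2.sOut ω.2.firstHitG) ≠ .straight →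
        cost (slotOfSide (ω.ext₃ hr).1) (ω.ext₃ hr).2.mids = 5 →
          phaseIndex (ω.ext₃ hr).2.mids = 3 ∨ phaseIndex (ω.ext₃ hr).2.mids = 0)
    (hex : ∃ (ω : ΩG (dom Dl) (w.side .W) f₀) (h : ω.IsB2a), ω.AJ hr h (toC (midPt (w.side .W))) ≠ 0 ∧
      arcKind (ω.2.sIn ω.2.firstHitG) (ω.2.sOut ω.2.firstHitG) ≠ .straight ∧
        cost (slotOfSide (ω.ext₃ hr).1) (ω.ext₃ hr).2.mids = 5) :
    ∃ θ ∈ Set.Ioo 0 π, vertexFunctional (printedWeights θ) tFiveEighths (ybCoeff θ) Dl (w.side .W) f₀ ≠ 0 := by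
  obtain ⟨hfin, -⟩ := vertexFunctional_printed_zero_set_finite_below_of_phase Dl hh hr hbelow hcol hphase hex
  by_contra hno
  push Not at hno
  have hsub : Set.Ioo (0 : ℝ) π ⊆
      {θ ∈ Set.Ioo 0 π | vertexFunctional (printedWeights θ) tFiveEighths (ybCoeff θ) Dl (w.side .W) f₀ = 0} :=
    fun θ hθ => ⟨hθ, hno θ hθ⟩
  exact (Set.Ioo_infinite Real.pi_pos).mono hsub |> fun hinf => hinf hfin

end Literature.Barriers.CriticalPhenomena.PlaquetteWalk
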